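import Summits.CriticalPhenomena.PercolationContinuityZ3.Theorems.PercNearOneGluingNoHeavyLowerTailEGSeries
import Summits.CriticalPhenomena.PercolationContinuityZ3.Theorems.PercNearOneGluingNoHeavyLowerTailCILSteinerSkeletonDegTwo
import HarnessLib

/-!
# `NoHeavyLowerTail` (stmt-CriticalPhenomena-4575) — EVENT GLUING (sharp GM-CIL(1)) at every observer whose Steiner component
# is a path or a cycle with relay hairs, every most-detached relay as witness

Support file (prover `prim-hp-2`, deletion–contraction line; `--supports stmt-CriticalPhenomena-4575`).  No definitions, no named
facts, no sorries.  Event-gluing copy of `…CILSteinerSkeletonDegTwo` (same induction, same three moves — relay-neighboured base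
`EGTransfer.eg_of_relayNeighbours`, pendant step `EGTransfer.eg_oneSteiner_of`, series step `eg_twoSteiner_of`), for a fixed sink
`b` outside the component: observer event `{o ↔ A} ∩ {o ↮ b}`, witness event `{c ↮ b}`, "most detached" = maximiser of `μ(· ↮ b)`.

* `EGSteinerSkeleton.eg_of_componentDegLeTwo` — `μ(o ↔ A, o ↮ b) ≤ μ(c ↮ b)` for every most-detached relay `c`, whenever the
  Steiner component of `o` has maximum degree two (arbitrary relay hairs, arbitrary rest of the graph) and does not contain `b`;
  `…_exists` — with some relay.  On a uniform star sink (`b` = the ghost of `Literature…GhostVertex`): sharp GM-CIL(1) with every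
  GM-champion, i.e. Kozma–Nitzan's inequality (2) in the weak form `P(o ↔ A, o ↮ g) ≤ max_a P(a ↮ g)` beyond Theorems 4–5; for
  a general sink: the additive gluing inequality of stmt-CriticalPhenomena-4576 for this observer class.
-/

noncomputable section

namespace Summit.CriticalPhenomena.PercolationContinuityZ3.Theorems

open MeasureTheory Set Literature.Probability.LatticeModels Literature.Probability.Percolation
open scoped Classical BigOperators

variable {n : ℕ}

namespace EGSteinerSkeleton

open CILOneSteiner ChampionStability MergeStability RelayNbhd CILTwoSteiner EGTransfer SteinerSkeleton

/-- **Event gluing (every most-detached relay) at every observer of a Steiner component of maximum degree two** —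
measure-bounded form for the induction (sink `b ∉ C`). -/
theorem eg_of_componentDegLeTwo_aux (A C : Finset (Fin n)) (b : Fin n) (hbC : b ∉ C) :
    ∀ (m : ℕ) (w : Sym2 (Fin n) → unitInterval),
      (Finset.univ.filter fun v : Fin n => v ∉ A ∧ ∃ u : Fin n, u ≠ v ∧ w s(v, u) ≠ 0).card ≤ m →
      (∀ v ∈ C, v ∉ A → ∀ u : Fin n, u ≠ v → u ∉ A → w s(v, u) ≠ 0 → u ∈ C) →
      (∀ v ∈ C, v ∉ A → ∃ x y : Fin n, ∀ u : Fin n, u ≠ v → u ∉ A → w s(v, u) ≠ 0 → u = x ∨ u = y) →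
      ∀ o ∈ C, o ∉ A → ∀ c ∈ A, (∀ a ∈ A,
        (prodBernoulli w).real {ω : BondConfig (Fin n) | ω ∉ openConn a b} ≤
          (prodBernoulli w).real {ω : BondConfig (Fin n) | ω ∉ openConn c b}) →
      (prodBernoulli w).real {ω : BondConfig (Fin n) |
          (∃ a ∈ A, ω ∈ openConn o a) ∧ ω ∉ openConn o b} ≤
        (prodBernoulli w).real {ω : BondConfig (Fin n) | ω ∉ openConn c b} := by
  intro m
  induction m with
  | zero =>
    intro w hm _ _ o _ ho c _ _
    -- `o` carries no positive pair
    have hiso : ∀ v : Fin n, v ≠ o → (w s(o, v) : ℝ) = 0 := by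
      intro v hv
      by_contra hne
      have hne' : w s(o, v) ≠ 0 := fun h => hne (by rw [h]; rfl)
      have hmem : o ∈ (Finset.univ.filter fun v : Fin n => v ∉ A ∧ ∃ u : Fin n, u ≠ v ∧ w s(v, u) ≠ 0) :=
        Finset.mem_filter.2 ⟨Finset.mem_univ _, ho, v, hv, hne'⟩
      have := Finset.card_pos.2 ⟨o, hmem⟩
      omega
    rw [real_EGL_eq_zero_of_isolated w A o b ho hiso]
    exact measureReal_nonneg
  | succ m ih =>
    intro w hm hC hdeg o hoC ho c hc hchamp
    have hbo : b ≠ o := fun h => hbC (h ▸ hoC)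
    -- relay-neighboured observer
    by_cases hrel : ∀ v : Fin n, v ≠ o → v ∉ A → (w s(o, v) : ℝ) = 0
    · exact eg_of_relayNeighbours A o b ho _ w rfl hrel c hc hchamp
    push Not at hrel
    obtain ⟨x, hxo, hx, hx0⟩ := hrel
    have hx0' : w s(o, x) ≠ 0 := fun h => hx0 (by rw [h]; rfl)
    have hpair : ∃ u : Fin n, u ≠ o ∧ w s(o, u) ≠ 0 := ⟨x, hxo, hx0'⟩
    obtain ⟨a₁, b₁, hab⟩ := hdeg o hoC ho
    have hxC : x ∈ C := hC o hoC ho x hxo hx hx0'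
    by_cases hone : ∀ v : Fin n, v ≠ o → v ∉ A → v ≠ x → (w s(o, v) : ℝ) = 0
    · -- ONE non-relay neighbour: the modular one-Steiner step, hypothesis from the induction hypothesis in `G − o`
      set w0 : Sym2 (Fin n) → unitInterval := pinW w {e : Sym2 (Fin n) | o ∈ e ∧ ¬ e.IsDiag} ∅ with hw0
      have hm0 : (Finset.univ.filter fun v : Fin n => v ∉ A ∧ ∃ u : Fin n, u ≠ v ∧ w0 s(v, u) ≠ 0).card ≤ m := by
        have hlt := measure_lt w w0 A o ho hpair (fun u hu => by rw [hw0]; exact pinW_star_mk w hu)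
          (fun v _ _ u hu hne => ⟨u, hu, ne_zero_of_pinW_ne_zero w o (by rw [hw0] at hne; exact hne)⟩)
        omega
      have hC0 : ∀ v ∈ C, v ∉ A → ∀ u : Fin n, u ≠ v → u ∉ A → w0 s(v, u) ≠ 0 → u ∈ C :=
        fun v hvC hvA u hu huA hne => hC v hvC hvA u hu huA (ne_zero_of_pinW_ne_zero w o (by rw [hw0] at hne; exact hne))
      have hdeg0 : ∀ v ∈ C, v ∉ A → ∃ x y : Fin n, ∀ u : Fin n, u ≠ v → u ∉ A → w0 s(v, u) ≠ 0 → u = x ∨ u = y := by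
        intro v hvC hvA
        obtain ⟨x', y', h'⟩ := hdeg v hvC hvA
        exact ⟨x', y', fun u hu huA hne => h' u hu huA (ne_zero_of_pinW_ne_zero w o (by rw [hw0] at hne; exact hne))⟩
      refine eg_oneSteiner_of A o x b ho hx hxo hbo _ w rfl hone ?_ c hc hchamp
      intro c' hc' hchamp'
      rw [← hw0] at hchamp' ⊢
      exact ih w0 hm0 hC0 hdeg0 x hxC hx c' hc' hchamp'
    · -- TWO non-relay neighbours `x ≠ y`: the modular observer series law, hypotheses from the induction hypothesis in `w₃`
      push Not at hone
      obtain ⟨y, hyo, hy, hyx, hy0⟩ := hone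
      have hy0' : w s(o, y) ≠ 0 := fun h => hy0 (by rw [h]; rfl)
      have hyC : y ∈ C := hC o hoC ho y hyo hy hy0'
      have hxy : x ≠ y := fun h => hyx h.symm
      have hox : o ≠ x := fun h => hxo h.symm
      have hoy : o ≠ y := fun h => hyo h.symm
      -- every non-relay neighbour of `o` is `x` or `y`
      have hxab : x = a₁ ∨ x = b₁ := hab x hxo hx hx0'
      have hyab : y = a₁ ∨ y = b₁ := hab y hyo hy hy0'
      have hoN : ∀ v : Fin n, v ≠ o → v ∉ A → v ≠ x → v ≠ y → (w s(o, v) : ℝ) = 0 := by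
        intro v hvo hvA hvx hvy
        by_contra hne
        have hne' : w s(o, v) ≠ 0 := fun h => hne (by rw [h]; rfl)
        rcases hab v hvo hvA hne' with rfl | rfl
        · rcases hxab with h | h
          · exact hvx h.symm
          · rcases hyab with h' | h'
            · exact hvy h'.symm
            · exact hxy (h.trans h'.symm)
        · rcases hxab with h | h
          · rcases hyab with h' | h'
            · exact hxy (h.trans h'.symm)
            · exact hvy h'.symm
          · exact hvx h.symm
      -- the series-reduced graph, written out
      set w₃ : Sym2 (Fin n) → unitInterval := Function.update (pinW w {e : Sym2 (Fin n) | o ∈ e ∧ ¬ e.IsDiag} ∅) s(x, y)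
        ⟨1 - (1 - (w s(x, y) : ℝ)) * (1 - (w s(o, x) : ℝ) * w s(o, y)), HullPort.seriesWeight_mem w o x y⟩ with hw₃
      have hg_o : o ∉ s(x, y) := by
        rw [Sym2.mem_iff, not_or]; exact ⟨hox, hoy⟩
      have h₃z : ∀ v : Fin n, v ≠ o → w₃ s(o, v) = 0 := by
        intro v hv
        have hne : s(o, v) ≠ s(x, y) := fun h => hg_o (h ▸ Sym2.mem_mk_left o v)
        rw [hw₃, Function.update_of_ne hne]
        exact pinW_star_mk w hv
      have h₃zz : w₃ s(o, o) = w s(o, o) := by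
        have hne : s(o, o) ≠ s(x, y) := fun h => hg_o (h ▸ Sym2.mem_mk_left o o)
        have hdiag : s(o, o) ∉ {e : Sym2 (Fin n) | o ∈ e ∧ ¬ e.IsDiag} := by
          rintro ⟨-, h⟩; exact h (Sym2.mk_isDiag_iff.2 rfl)
        rw [hw₃, Function.update_of_ne hne, pinW_apply_of_not_mem w ∅ hdiag]
      have h₃off : ∀ e : Sym2 (Fin n), o ∉ e → e ≠ s(x, y) → w₃ e = w e := by
        intro e hoe hne
        have hmem : e ∉ {e : Sym2 (Fin n) | o ∈ e ∧ ¬ e.IsDiag} := fun h => hoe h.1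
        rw [hw₃, Function.update_of_ne hne, pinW_apply_of_not_mem w ∅ hmem]
      have h₃xy : (w₃ s(x, y) : ℝ) = 1 - (1 - (w s(x, y) : ℝ)) * (1 - (w s(o, x) : ℝ) * w s(o, y)) := by
        rw [hw₃, Function.update_self]
      -- positive pairs of `w₃` away from `s(x,y)` are positive pairs of `w` not at `o`
      have h₃pos : ∀ v u : Fin n, v ≠ o → u ≠ v → w₃ s(v, u) ≠ 0 → u ≠ o ∧ (s(v, u) = s(x, y) ∨ w s(v, u) ≠ 0) := by
        intro v u hvo huv hne
        have huo : u ≠ o := by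
          rintro rfl
          rw [Sym2.eq_swap] at hne
          exact hne (h₃z v hvo)
        refine ⟨huo, ?_⟩
        by_cases hg : s(v, u) = s(x, y)
        · exact Or.inl hg
        · right
          have hoe : o ∉ s(v, u) := by
            rw [Sym2.mem_iff, not_or]; exact ⟨fun h => hvo h.symm, fun h => huo h.symm⟩
          rwa [h₃off _ hoe hg] at hne
      have hm3 : (Finset.univ.filter fun v : Fin n => v ∉ A ∧ ∃ u : Fin n, u ≠ v ∧ w₃ s(v, u) ≠ 0).card ≤ m := by
        have hlt := measure_lt w w₃ A o ho hpair h₃z (fun v _ hvo u hu hne => by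
          obtain ⟨-, h⟩ := h₃pos v u hvo hu hne
          rcases h with hg | h
          · -- `v ∈ {x, y}`: it has the pair to `o` in `w`
            have hv : v = x ∨ v = y := by
              have : v ∈ s(x, y) := by rw [← hg]; exact Sym2.mem_mk_left v u
              exact Sym2.mem_iff.1 this
            rcases hv with rfl | rfl
            · exact ⟨o, hox, by rw [Sym2.eq_swap]; exact hx0'⟩
            · exact ⟨o, hoy, by rw [Sym2.eq_swap]; exact hy0'⟩
          · exact ⟨u, hu, h⟩)
        omega
      -- `w₃` is in the class (relative to `C`)
      have hC3 : ∀ v ∈ C, v ∉ A → ∀ u : Fin n, u ≠ v → u ∉ A → w₃ s(v, u) ≠ 0 → u ∈ C := by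
        intro v hvC hvA u hu huA hne
        by_cases hvo : v = o
        · subst hvo; exact absurd (h₃z u hu) hne
        obtain ⟨-, h⟩ := h₃pos v u hvo hu hne
        rcases h with hg | h
        · have : u ∈ s(x, y) := by rw [← hg]; exact Sym2.mem_mk_right v u
          rcases Sym2.mem_iff.1 this with h1 | h1
          · exact h1 ▸ hxC
          · exact h1 ▸ hyC
        · exact hC v hvC hvA u hu huA h
      have hdeg3 : ∀ v ∈ C, v ∉ A → ∃ x' y' : Fin n, ∀ u : Fin n, u ≠ v → u ∉ A → w₃ s(v, u) ≠ 0 → u = x' ∨ u = y' := by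
        intro v hvC hvA
        by_cases hvo : v = o
        · subst hvo
          exact ⟨v, v, fun u hu _ hne => absurd (h₃z u hu) hne⟩
        -- the old witnesses for `v`, with `o` replaced by the new neighbour when `v ∈ {x, y}`
        obtain ⟨a', b', h'⟩ := hdeg v hvC hvA
        by_cases hvx : v = x
        · subst hvx
          -- `o` is one of `a', b'`; the other one and `y` are the witnesses
          have hoab : o = a' ∨ o = b' := h' o (Ne.symm hvo) ho (by rw [Sym2.eq_swap]; exact hx0')
          have key : ∀ u : Fin n, u ≠ v → u ∉ A → w₃ s(v, u) ≠ 0 → u ≠ o ∧ (u = y ∨ u = a' ∨ u = b') := by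
            intro u hu huA hne
            obtain ⟨huo, h⟩ := h₃pos v u hvo hu hne
            refine ⟨huo, ?_⟩
            rcases h with hg | h
            · exact Or.inl (Sym2.congr_right.1 hg)
            · exact Or.inr (h' u hu huA h)
          rcases hoab with hoa | hob
          · refine ⟨b', y, fun u hu huA hne => ?_⟩
            obtain ⟨huo, h⟩ := key u hu huA hne
            rcases h with h | h | h
            · exact Or.inr h
            · exact absurd (h.trans hoa.symm) huo
            · exact Or.inl h
          · refine ⟨a', y, fun u hu huA hne => ?_⟩
            obtain ⟨huo, h⟩ := key u hu huA hne
            rcases h with h | h | h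
            · exact Or.inr h
            · exact Or.inl h
            · exact absurd (h.trans hob.symm) huo
        by_cases hvy : v = y
        · subst hvy
          have hoab : o = a' ∨ o = b' := h' o (Ne.symm hvo) ho (by rw [Sym2.eq_swap]; exact hy0')
          have key : ∀ u : Fin n, u ≠ v → u ∉ A → w₃ s(v, u) ≠ 0 → u ≠ o ∧ (u = x ∨ u = a' ∨ u = b') := by
            intro u hu huA hne
            obtain ⟨huo, h⟩ := h₃pos v u hvo hu hne
            refine ⟨huo, ?_⟩
            rcases h with hg | h
            · left
              have : u ∈ s(x, v) := by rw [← hg]; exact Sym2.mem_mk_right v u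
              rcases Sym2.mem_iff.1 this with h1 | h1
              · exact h1
              · exact absurd h1 hu
            · exact Or.inr (h' u hu huA h)
          rcases hoab with hoa | hob
          · refine ⟨b', x, fun u hu huA hne => ?_⟩
            obtain ⟨huo, h⟩ := key u hu huA hne
            rcases h with h | h | h
            · exact Or.inr h
            · exact absurd (h.trans hoa.symm) huo
            · exact Or.inl h
          · refine ⟨a', x, fun u hu huA hne => ?_⟩
            obtain ⟨huo, h⟩ := key u hu huA hne
            rcases h with h | h | h
            · exact Or.inr h
            · exact Or.inl h
            · exact absurd (h.trans hob.symm) huo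
        · refine ⟨a', b', fun u hu huA hne => ?_⟩
          obtain ⟨huo, h⟩ := h₃pos v u hvo hu hne
          rcases h with hg | h
          · exfalso
            have : v ∈ s(x, y) := by rw [← hg]; exact Sym2.mem_mk_left v u
            rcases Sym2.mem_iff.1 this with h1 | h1
            · exact hvx h1
            · exact hvy h1
          · exact h' u hu huA h
      refine eg_twoSteiner_of A o x y b ho hx hy hxo hyo hxy hbo w₃ h₃z ?_ ?_ _ w rfl hoN h₃zz h₃off h₃xy c hc hchamp
      · intro c' hc' hchamp'
        exact ih w₃ hm3 hC3 hdeg3 x hxC hx c' hc' hchamp'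
      · intro c' hc' hchamp'
        exact ih w₃ hm3 hC3 hdeg3 y hyC hy c' hc' hchamp'

/-- **Event gluing at every observer of a Steiner component of maximum degree two, every most-detached relay as witness.**
Let `C ∋ o` (`o ∉ A`) be closed under positive-weight pairs between non-relays, every non-relay in `C` having at most two non-relay
positive-weight neighbours (the Steiner component of `o` is a path or a cycle dressed with arbitrary relay hairs; the rest of the graph
is unrestricted), and let the sink `b` lie outside `C`.  Then `μ(o ↔ A, o ↮ b) ≤ μ(c ↮ b)` for every most-detached relay `c`.
On a uniform star sink (`b` = ghost) this is the sharp geometric-moment cumulative isolation inequality GM-CIL(1) with every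
GM-champion; for a general sink it is the additive gluing inequality of stmt-CriticalPhenomena-4576 with `t = max_a P(a ↮ b)`, for this
class of observers.  [cite: KozmaNitzan2024, Thms 4–5 (pp. 12–13) — event-gluing analogue for Steiner paths/cycles with every witness;
VandenbergHaggstromKahn2005, Thm. 1.5 (p. 7)] -/
theorem eg_of_componentDegLeTwo (w : Sym2 (Fin n) → unitInterval) (A C : Finset (Fin n)) (o b : Fin n)
    (hoC : o ∈ C) (ho : o ∉ A) (hbC : b ∉ C)
    (hC : ∀ v ∈ C, v ∉ A → ∀ u : Fin n, u ≠ v → u ∉ A → w s(v, u) ≠ 0 → u ∈ C)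
    (hdeg : ∀ v ∈ C, v ∉ A → ∃ x y : Fin n, ∀ u : Fin n, u ≠ v → u ∉ A → w s(v, u) ≠ 0 → u = x ∨ u = y)
    (c : Fin n) (hc : c ∈ A)
    (hdet : ∀ a ∈ A,
      (prodBernoulli w).real {ω : BondConfig (Fin n) | ω ∉ openConn a b} ≤
        (prodBernoulli w).real {ω : BondConfig (Fin n) | ω ∉ openConn c b}) :
    (prodBernoulli w).real {ω : BondConfig (Fin n) | (∃ a ∈ A, ω ∈ openConn o a) ∧ ω ∉ openConn o b} ≤
      (prodBernoulli w).real {ω : BondConfig (Fin n) | ω ∉ openConn c b} :=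
  eg_of_componentDegLeTwo_aux A C b hbC _ w le_rfl hC hdeg o hoC ho c hc hdet

/-- **The same with SOME relay as witness** (`∃ a ∈ A`, `A` nonempty): event gluing with constant `1` for this class. -/
theorem eg_of_componentDegLeTwo_exists (w : Sym2 (Fin n) → unitInterval) (A C : Finset (Fin n)) (o b : Fin n)
    (hA : A.Nonempty) (hoC : o ∈ C) (ho : o ∉ A) (hbC : b ∉ C)
    (hC : ∀ v ∈ C, v ∉ A → ∀ u : Fin n, u ≠ v → u ∉ A → w s(v, u) ≠ 0 → u ∈ C)
    (hdeg : ∀ v ∈ C, v ∉ A → ∃ x y : Fin n, ∀ u : Fin n, u ≠ v → u ∉ A → w s(v, u) ≠ 0 → u = x ∨ u = y) :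
    ∃ a ∈ A, (prodBernoulli w).real {ω : BondConfig (Fin n) | (∃ a' ∈ A, ω ∈ openConn o a') ∧ ω ∉ openConn o b} ≤
      (prodBernoulli w).real {ω : BondConfig (Fin n) | ω ∉ openConn a b} := by
  obtain ⟨c, hc, hdet⟩ := exists_mostDetached (prodBernoulli w) A hA b
  exact ⟨c, hc, eg_of_componentDegLeTwo w A C o b hoC ho hbC hC hdeg c hc hdet⟩

/-- **Additive gluing (the inequality of crux stmt-CriticalPhenomena-4576) for observers whose Steiner component is a path or a
cycle with relay hairs.**  Same class as `eg_of_componentDegLeTwo` (`A ≠ ∅`, sink `b` outside the component, NO separation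
hypothesis): if every relay is joined to `b` with probability `≥ 1 − t` (`t ≥ 0`) then `P(o ↔ A) − t ≤ P(o ↔ b)`.
[cite: KozmaNitzan2024, Conjecture 1 / inequality (2) (p. 3) — additive consequence, for this class] -/
theorem additiveGluing_of_componentDegLeTwo (w : Sym2 (Fin n) → unitInterval) (A C : Finset (Fin n)) (o b : Fin n)
    (hA : A.Nonempty) (hoC : o ∈ C) (ho : o ∉ A) (hbC : b ∉ C)
    (hC : ∀ v ∈ C, v ∉ A → ∀ u : Fin n, u ≠ v → u ∉ A → w s(v, u) ≠ 0 → u ∈ C)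
    (hdeg : ∀ v ∈ C, v ∉ A → ∃ x y : Fin n, ∀ u : Fin n, u ≠ v → u ∉ A → w s(v, u) ≠ 0 → u = x ∨ u = y)
    (t : ℝ) (hrel : ∀ a ∈ A, 1 - t ≤ (prodBernoulli w).real (openConn a b)) :
    (prodBernoulli w).real (⋃ a ∈ A, openConn o a) - t ≤ (prodBernoulli w).real (openConn o b) := by
  haveI : IsProbabilityMeasure (prodBernoulli w) := inferInstance
  obtain ⟨c, hc, h⟩ := eg_of_componentDegLeTwo_exists w A C o b hA hoC ho hbC hC hdeg
  have hmeas : ∀ S : Set (BondConfig (Fin n)), MeasurableSet S := fun S => (Set.toFinite S).measurableSet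
  -- the witness event has probability at most `t`
  have hcb : (prodBernoulli w).real {ω : BondConfig (Fin n) | ω ∉ openConn c b} ≤ t := by
    have hcompl : {ω : BondConfig (Fin n) | ω ∉ openConn c b} = (openConn c b : Set (BondConfig (Fin n)))ᶜ := rfl
    rw [hcompl, probReal_compl_eq_one_sub (hmeas _)]
    have := hrel c hc
    linarith
  -- `{o ↔ A} ⊆ ({o ↔ A} ∩ {o ↮ b}) ∪ {o ↔ b}`
  have hsub : (⋃ a ∈ A, (openConn o a : Set (BondConfig (Fin n)))) ⊆
      {ω : BondConfig (Fin n) | (∃ a ∈ A, ω ∈ openConn o a) ∧ ω ∉ openConn o b} ∪ openConn o b := by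
    intro ω hω
    simp only [mem_iUnion, exists_prop] at hω
    obtain ⟨a, ha, hoa⟩ := hω
    by_cases hob : ω ∈ openConn o b
    · exact Or.inr hob
    · exact Or.inl ⟨⟨a, ha, hoa⟩, hob⟩
  have h1 : (prodBernoulli w).real (⋃ a ∈ A, (openConn o a : Set (BondConfig (Fin n)))) ≤
      (prodBernoulli w).real {ω : BondConfig (Fin n) | (∃ a ∈ A, ω ∈ openConn o a) ∧ ω ∉ openConn o b} +
        (prodBernoulli w).real (openConn o b) :=
    (measureReal_mono hsub).trans (measureReal_union_le _ _)
  linarith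

end EGSteinerSkeleton

end Summit.CriticalPhenomena.PercolationContinuityZ3.Theorems

end
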